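import Mathlib

/-!
# Clause 13-R, the BORDERING LEMMA: injectivity-with-bound of `L` plus transversality of the rate column `r` to `range L`
# ⟹ injectivity-with-bound of the bordered map `(v, t) ↦ L v + t·r`

Route `FilamentSkeletonRss`, Variant A1R (clause 13-J ↦ 13-R retype; DIRECTOR-NS dss_113–115, tenure ns-filament-repair-plan g26): the ∃-side child
`Clause13RNearStraightL` (stmt-NavierStokesRegularity-23612) asks for the clause-13-J weighted injectivity of the linearised normal-velocity map `L = DT`
AUGMENTED by the rate column `r = −P_n(e₃×X)` (unknown `dα`), with `|dα|√Γ ≤ cnd·L₀` next to `‖Y‖ ≤ cnd·L₀`.  The mechanism that turns «13-J + rate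
transversality» into 13-R is this abstract Hilbert-space lemma: if `‖L v‖ ≥ c‖v‖` and some unit vector `n ⟂ range L` has `|⟪n, r⟫| ≥ δ > 0` (the
quantity the MODEL job j318115 measured as `r_α·‖r‖`: the distance of the rate column from the range of the phase operator), then for all `(v, t)`

  `|t| ≤ δ⁻¹·‖L v + t·r‖`   and   `‖v‖ ≤ c⁻¹·(1 + ‖r‖/δ)·‖L v + t·r‖`.

(Project on `n` for the first; triangle inequality for the second.)  Typing-agnostic; lane ns-filament-19175-p1 g14; `--supports stmt-NavierStokesRegularity-23612
--as helper`.
HONEST FRAMING: an elementary functional-analytic lemma attached to a HYPOTHETICAL filament skeleton's linearised operator on the NEGATIVE side of a MODEL route;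
nothing here bears on Navier–Stokes regularity or blow-up.
-/

noncomputable section

open Real

namespace Summit.NavierStokesRegularity.NavierStokesRegularity.Theorems.MatchedKernel
set_option linter.dupNamespace false

open scoped InnerProductSpace

variable {V W : Type*} [NormedAddCommGroup V] [NormedSpace ℝ V] [NormedAddCommGroup W] [InnerProductSpace ℝ W]

/-- **Rate bound of the bordered map**: a unit vector `n` orthogonal to `range L` with `δ ≤ |⟪n, r⟫|` detects the coefficient of `r`:
`|t| ≤ δ⁻¹‖L v + t•r‖`. [folklore] -/
theorem bordered_rate_bound (L : V →ₗ[ℝ] W) (r n : W) {δ : ℝ} (hδ : 0 < δ) (hn1 : ‖n‖ = 1)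
    (hn : ∀ v : V, ⟪n, L v⟫_ℝ = 0) (hr : δ ≤ |⟪n, r⟫_ℝ|) (v : V) (t : ℝ) :
    |t| ≤ δ⁻¹ * ‖L v + t • r‖ := by
  have hproj : ⟪n, L v + t • r⟫_ℝ = t * ⟪n, r⟫_ℝ := by
    rw [inner_add_right, hn v, inner_smul_right, zero_add]
  have hcs : |⟪n, L v + t • r⟫_ℝ| ≤ ‖L v + t • r‖ := by
    have h := abs_real_inner_le_norm n (L v + t • r)
    rwa [hn1, one_mul] at h
  rw [hproj, abs_mul] at hcs
  have h1 : |t| * δ ≤ ‖L v + t • r‖ := le_trans (mul_le_mul_of_nonneg_left hr (abs_nonneg t)) hcs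
  rw [le_inv_mul_iff₀' hδ] at *
  · linarith [h1]

/-- **THE BORDERING LEMMA**: `‖L v‖ ≥ c‖v‖` for all `v` and a unit `n ⟂ range L` with `|⟪n, r⟫| ≥ δ > 0` give, for every `(v, t)`,
`|t| ≤ δ⁻¹‖L v + t•r‖` and `‖v‖ ≤ c⁻¹(1 + ‖r‖/δ)‖L v + t•r‖` — injectivity with bound of `(v, t) ↦ L v + t•r`. [folklore] -/
theorem bordered_injectivity (L : V →ₗ[ℝ] W) (r n : W) {c δ : ℝ} (hc : 0 < c) (hδ : 0 < δ)
    (hL : ∀ v : V, c * ‖v‖ ≤ ‖L v‖) (hn1 : ‖n‖ = 1) (hn : ∀ v : V, ⟪n, L v⟫_ℝ = 0) (hr : δ ≤ |⟪n, r⟫_ℝ|)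
    (v : V) (t : ℝ) :
    |t| ≤ δ⁻¹ * ‖L v + t • r‖ ∧ ‖v‖ ≤ c⁻¹ * (1 + ‖r‖ / δ) * ‖L v + t • r‖ := by
  have ht := bordered_rate_bound L r n hδ hn1 hn hr v t
  refine ⟨ht, ?_⟩
  -- `‖L v‖ ≤ ‖L v + t r‖ + |t|‖r‖ ≤ (1 + ‖r‖/δ)‖L v + t r‖`
  have h1 : ‖L v‖ ≤ ‖L v + t • r‖ + |t| * ‖r‖ := by
    have h := norm_sub_le (L v + t • r) (t • r)
    rw [add_sub_cancel_right, norm_smul, Real.norm_eq_abs] at h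
    exact h
  have h2 : |t| * ‖r‖ ≤ δ⁻¹ * ‖L v + t • r‖ * ‖r‖ := mul_le_mul_of_nonneg_right ht (norm_nonneg _)
  have h3 : ‖L v‖ ≤ (1 + ‖r‖ / δ) * ‖L v + t • r‖ := by
    calc ‖L v‖ ≤ ‖L v + t • r‖ + δ⁻¹ * ‖L v + t • r‖ * ‖r‖ := by linarith
      _ = (1 + ‖r‖ / δ) * ‖L v + t • r‖ := by rw [div_eq_mul_inv]; ring
  have h4 : c * ‖v‖ ≤ (1 + ‖r‖ / δ) * ‖L v + t • r‖ := (hL v).trans h3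
  rw [mul_assoc]
  exact (le_inv_mul_iff₀ hc).2 h4

/-- Transversality in the S0/F2 currency: if the RANGE DISTANCE of `r` is witnessed by a unit `n ⟂ range L` with `|⟪n, r⟫| ≥ ϱ‖r‖` (`ϱ` = the
scale-free `r_α` of RESULTS-S0-rate-row-g14), the constants read `δ = ϱ‖r‖`: `|t|·‖r‖ ≤ ϱ⁻¹‖L v + t•r‖`, `‖v‖ ≤ c⁻¹(1 + ϱ⁻¹)‖L v + t•r‖`. [folklore] -/
theorem bordered_injectivity_scaleFree (L : V →ₗ[ℝ] W) (r n : W) {c ϱ : ℝ} (hc : 0 < c) (hϱ : 0 < ϱ) (hr0 : r ≠ 0)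
    (hL : ∀ v : V, c * ‖v‖ ≤ ‖L v‖) (hn1 : ‖n‖ = 1) (hn : ∀ v : V, ⟪n, L v⟫_ℝ = 0) (hr : ϱ * ‖r‖ ≤ |⟪n, r⟫_ℝ|)
    (v : V) (t : ℝ) :
    |t| * ‖r‖ ≤ ϱ⁻¹ * ‖L v + t • r‖ ∧ ‖v‖ ≤ c⁻¹ * (1 + ϱ⁻¹) * ‖L v + t • r‖ := by
  have hr' : 0 < ‖r‖ := norm_pos_iff.2 hr0
  have hδ : 0 < ϱ * ‖r‖ := mul_pos hϱ hr'
  obtain ⟨h1, h2⟩ := bordered_injectivity L r n hc hδ hL hn1 hn hr v t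
  constructor
  · have := mul_le_mul_of_nonneg_right h1 hr'.le
    calc |t| * ‖r‖ ≤ (ϱ * ‖r‖)⁻¹ * ‖L v + t • r‖ * ‖r‖ := this
      _ = ϱ⁻¹ * ‖L v + t • r‖ := by field_simp
  · calc ‖v‖ ≤ c⁻¹ * (1 + ‖r‖ / (ϱ * ‖r‖)) * ‖L v + t • r‖ := h2
      _ = c⁻¹ * (1 + ϱ⁻¹) * ‖L v + t • r‖ := by
          congr 2; field_simp

end Summit.NavierStokesRegularity.NavierStokesRegularity.Theorems.MatchedKernel

end
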